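import Summits.QuantumFields.YangMills.Theorems.LuscherReductionDressedRitzPolyakovLiftStaticsOfSeparationInstances
import Summits.QuantumFields.YangMills.Theorems.FemtoTransferGapZeroModes
import Summits.QuantumFields.YangMills.Theorems.FemtoTransferGapRungW1upProfiles
import HarnessLib

/-!
# Line «polyakovlift» on crux `DressedRitz` (stmt-QuantumFields-20205), stub S-STAT — a WORKED INSTANCE of the separation certificate:
# the symmetric link profile `Σ_μ g_r(V_μ)` and the antisymmetric difference `g_r(V₀) − g_r(V₁)` are exactly uncorrelated flowed-Polyakov channels

Fleet-service module of seat ym-infvol-p1 g6 (route `LuscherReduction`, femto rung R2b1).  A concrete, fully explicit inhabitant of `PairSeparated`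
(`…StaticsOfSeparation.lean`): with the tree's continuous class- and centre-symmetric one-link profile `profA r` (`…RungW1upProfiles.lean`), the one-site
functions `F_r(V) = Σ_μ profA r (V_μ)` (`S₃`-symmetric, `A₁`-type) and `H_r(V) = profA r (V₀) − profA r (V₁)` (odd under the transposition `(0 1)`) are
physical (`isPhys_of_invariant`) and `(0 1)`-separated (`pairSeparated_of_transposition`); hence, for EVERY fine lattice `(ℤ/L)³`, every `β`, every raw
vacuum, their dressed flowed-Polyakov channel vectors are exactly uncorrelated and uncoupled (`dressed_pair_eq_zero_of_pairSeparated`) — a regression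
instance showing the certificate API is inhabited by honest one-site functions.

HONEST FRAMING: an example; fixed-lattice symmetry bookkeeping on the conditional femto rung R2b1; no renormalisation-group content; nothing here bears on
infinite volume, the continuum limit or the Clay gap.  Reference: M. Lüscher, NPB 219 (1983) 233, §2 [cite: Luscher1983, §2].
-/

set_option autoImplicit false

noncomputable section

open MeasureTheory Filter Topology
open Literature.MathematicalPhysics.QuantumFieldTheory
open scoped BigOperators

namespace Summit.QuantumFields.YangMills.Theorems.FemtoTransferGap.PolyakovLift

open Summit.QuantumFields.YangMills.Theorems.FemtoTransferGap

section Example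

variable (r : ℝ)

/-- **The symmetric link profile `F_r(V) = Σ_μ profA r (V_μ)` is a physical one-site function** (continuous, bounded by `3`, conjugation- and
centre-symmetric link by link). [cite: Luscher1983, §2] -/
theorem isPhys_sum_profA : IsPhys fun V : GaugeConfig 3 1 SU2 => ∑ μ : Fin 3, profA r (V ((0 : Site 3 1), μ)) := by
  refine isPhys_of_invariant ?_ ⟨3, fun U => ?_⟩ (fun V U => ?_) (fun k U => ?_)
  · exact continuous_finsetSum _ fun μ _ => (continuous_profA r).comp (continuous_apply (((0 : Site 3 1), μ) : Edge 3 1))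
  · rw [abs_of_nonneg (Finset.sum_nonneg fun μ _ => profA_nonneg r _)]
    calc ∑ μ : Fin 3, profA r (U (0, μ)) ≤ ∑ _μ : Fin 3, (1 : ℝ) := Finset.sum_le_sum fun μ _ => profA_le_one r _
      _ = 3 := by simp
  · exact Finset.sum_congr rfl fun μ _ => profA_conj r V _
  · refine Finset.sum_congr rfl fun μ _ => ?_
    by_cases h : μ = k
    · simp only [h, if_true, profA_center r negOne_mem_center]
    · simp only [h, if_false]

/-- **The antisymmetric difference `H_r(V) = profA r (V₀) − profA r (V₁)` is a physical one-site function.** [cite: Luscher1983, §2] -/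
theorem isPhys_profA_diff :
    IsPhys fun V : GaugeConfig 3 1 SU2 => profA r (V ((0 : Site 3 1), 0)) - profA r (V ((0 : Site 3 1), 1)) := by
  refine isPhys_of_invariant ?_ ⟨2, fun U => ?_⟩ (fun V U => ?_) (fun k U => ?_)
  · exact ((continuous_profA r).comp (continuous_apply (((0 : Site 3 1), (0 : Fin 3)) : Edge 3 1))).sub
      ((continuous_profA r).comp (continuous_apply (((0 : Site 3 1), (1 : Fin 3)) : Edge 3 1)))
  · have h0 := profA_nonneg r (U (0, 0)); have h0' := profA_le_one r (U (0, 0))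
    have h1 := profA_nonneg r (U (0, 1)); have h1' := profA_le_one r (U (0, 1))
    rw [abs_le]; constructor <;> linarith
  · simp only [profA_conj]
  · have hk : ∀ μ : Fin 3, profA r (if μ = k then negOne * U (0, μ) else U (0, μ)) = profA r (U (0, μ)) := fun μ => by
      by_cases h : μ = k
      · simp only [h, if_true, profA_center r negOne_mem_center]
      · simp only [h, if_false]
    simp only [hk]

/-- `F_r` is invariant under the axis transposition `(0 1)`. [folklore] -/
theorem sum_profA_comp_transposition (V : GaugeConfig 3 1 SU2) :
    (∑ μ : Fin 3, profA r (configPerm (Equiv.swap (0 : Fin 3) 1) V ((0 : Site 3 1), μ))) = ∑ μ : Fin 3, profA r (V ((0 : Site 3 1), μ)) := by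
  have hx : ∀ y : Site 3 1, y = 0 := fun y => Subsingleton.elim y 0
  simp only [configPerm_apply, hx (sitePerm _ _), Equiv.symm_swap]
  exact Equiv.sum_comp (Equiv.swap (0 : Fin 3) 1) (fun μ => profA r (V (0, μ)))

/-- `H_r` is odd under the axis transposition `(0 1)`. [folklore] -/
theorem profA_diff_comp_transposition (V : GaugeConfig 3 1 SU2) :
    profA r (configPerm (Equiv.swap (0 : Fin 3) 1) V ((0 : Site 3 1), 0)) - profA r (configPerm (Equiv.swap (0 : Fin 3) 1) V ((0 : Site 3 1), 1)) =
      -(profA r (V ((0 : Site 3 1), 0)) - profA r (V ((0 : Site 3 1), 1))) := by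
  have hx : ∀ y : Site 3 1, y = 0 := fun y => Subsingleton.elim y 0
  simp only [configPerm_apply, hx (sitePerm _ _), Equiv.symm_swap, Equiv.swap_apply_left, Equiv.swap_apply_right]
  ring

/-- ★ **A certified pair**: `F_r` and `H_r` are `PairSeparated` (transposition parity `(0 1)`). [cite: Luscher1983, §2] -/
theorem pairSeparated_sum_profA_diff :
    PairSeparated (fun V : GaugeConfig 3 1 SU2 => ∑ μ : Fin 3, profA r (V ((0 : Site 3 1), μ)))
      (fun V : GaugeConfig 3 1 SU2 => profA r (V ((0 : Site 3 1), 0)) - profA r (V ((0 : Site 3 1), 1))) :=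
  pairSeparated_of_transposition 0 1 (fun V => sum_profA_comp_transposition r V) (fun V => profA_diff_comp_transposition r V)

/-- ★ **Hence, in every fine `SU(2)` theory and for every raw vacuum, the dressed flowed-Polyakov channel vectors of `F_r` and `H_r` are exactly
uncorrelated and uncoupled**: `⟨u'_{F_r}, u'_{H_r}⟩ = 0` and `⟨u'_{F_r}, K_β u'_{H_r}⟩ = 0`. [cite: Luscher1983, §2] [cite: LuscherWolff1990] -/
theorem dressed_sum_profA_diff_eq_zero {L : ℕ} [NeZero L] (β : ℝ) {φ : GaugeConfig 3 L SU2 → ℝ} (hvac : IsRawVacuum β φ) :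
    l2 (dressedLiftVec β φ fun V : GaugeConfig 3 1 SU2 => ∑ μ : Fin 3, profA r (V ((0 : Site 3 1), μ)))
        (dressedLiftVec β φ fun V : GaugeConfig 3 1 SU2 => profA r (V ((0 : Site 3 1), 0)) - profA r (V ((0 : Site 3 1), 1))) = 0 ∧
      l2 (dressedLiftVec β φ fun V : GaugeConfig 3 1 SU2 => ∑ μ : Fin 3, profA r (V ((0 : Site 3 1), μ)))
        (transferApply β (dressedLiftVec β φ fun V : GaugeConfig 3 1 SU2 => profA r (V ((0 : Site 3 1), 0)) - profA r (V ((0 : Site 3 1), 1)))) = 0 :=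
  dressed_pair_eq_zero_of_pairSeparated β hvac (isPhys_sum_profA r) (isPhys_profA_diff r) (pairSeparated_sum_profA_diff r)

end Example

end Summit.QuantumFields.YangMills.Theorems.FemtoTransferGap.PolyakovLift

end
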